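import Literature.NumberTheory.Transcendental.KaehlerHodgeDolbeaultHarmonicProofs
import HarnessLib

/-!
# `∂̄`-harmonic forms are `∂̄`-closed: `ℋ^{p,q} ≤ Z^{p,q}_{∂̄}` (Voisin 2002, Cor. 5.13) — proofs

Theorems-only companion of `Literature/NumberTheory/Transcendental/KaehlerHodge.lean` (C12) for its
named fact `Literature.NumberTheory.Transcendental.dolbeaultHarmonicForms_le_dolbeaultClosedForms`
("`∂̄`-harmonic `(p,q)`-forms are `∂̄`-closed (compact Hermitian manifold), so
`ℋ^{p,q} ≤ Z^{p,q}_{∂̄}`"): C. Voisin, *Hodge Theory and Complex Algebraic Geometry I* (2002),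
§5.1.4, Cor. 5.13, p. 125 ("On a compact manifold, we have `Ker Δ_d = Ker d ∩ Ker d*` and the
analogous equalities for the three other Laplacians"), from Lemma 5.12
(`(α, Δα) = ‖dα‖² + ‖d*α‖²` "and the analogous equalities for the other Laplacians") and
Lemma 5.8 (§5.1.3: `∂̄* = -*∂*` is the formal adjoint of `∂̄` for the Hermitian `L²` metric, `X` a
complex manifold); D. Huybrechts, *Complex Geometry* (2005), Lemma 3.2.3 and Lemma 3.2.5
("`(Δ_∂̄(α), α) = ‖∂̄*α‖² + ‖∂̄α‖²`"). In particular `ℋ^{p,q} ⊆ Ker ∂̄ ∩ A^{p,q} = Z^{p,q}_{∂̄}`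
(Voisin, §5.1.4, Def. 5.14; Huybrechts, Def. 3.2.4).

## Main statements (all proved)

* `dolbeaultBar_eq_zero_of_isDolbeaultHarmonic_zero`: the degree-`0` patterns of
  `dolbeaultLaplacian` (`Δ_∂̄ = ∂̄*∂̄` on functions, and `Δ_∂̄ = 0` on a `0`-dimensional manifold,
  where there are no `1`-forms): a smooth `Δ_∂̄`-harmonic `0`-form is `∂̄`-closed —
  `0 = ⟪α, ∂̄*∂̄α⟫ = ⟪∂̄α, ∂̄α⟫` by Voisin's Lemma 5.8 (the tree theorem
  `MForm.cl2Inner_dolbeaultBar_left_of_isHermitian`, `KaehlerHodgeAdjointProofs.lean`) and the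
  positive-definiteness of the Hermitian `L²` product on smooth forms
  (`eq_zero_of_cl2Inner_self_eq_zero`, `KaehlerHodgeDolbeaultHarmonicProofs.lean`).
* `IsDolbeaultHarmonic.dolbeaultBar_eq_zero` — **Voisin Cor. 5.13 for `Δ_∂̄`, "`Ker Δ_∂̄ ⊆ Ker ∂̄`"
  in every degree**: in positive degree this is the forward half of the tree theorem
  `isDolbeaultHarmonic_iff_of_inner_tangentJ` (`KaehlerHodgeDolbeaultHarmonicProofs.lean`,
  Huybrechts Lemma 3.2.5), in degree `0` the previous statement.
* `dolbeaultHarmonicForms_le_dolbeaultClosedForms_of_inner_tangentJ` — **`ℋ^{p,q} ≤ Z^{p,q}_{∂̄}`**,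
  the usable theorem (compact complex manifold, `C^∞` metric Hermitian in the instance form
  `hJ : ⟪Jv, Jw⟫ = ⟪v, w⟫`, `vol_o` smooth): both sides are spans (`Submodule.span_le`) and each
  generator of `ℋ^{p,q}` is smooth, of type `(p,q)` and `∂̄`-closed (`mem_dolbeaultClosedForms`).
* `dolbeaultHarmonicForms_le_dolbeaultClosedForms_of_isManifold_complex` — on a complex manifold
  the named fact `dolbeaultHarmonicForms_le_dolbeaultClosedForms g o` holds *as declared* (bridge;
  this is the hypothesis `h₁` of `Literature/AlgebraicGeometry/Motives/HodgeDecompositionProofs.lean`).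
* `dolbeaultHarmonicForms_le_dolbeaultClosedForms_of_isManifold` (section *CorrectedFact*) — the
  named fact with the **corrected statement**, holomorphic atlas bound inside the `Prop` — and its
  discharge `dolbeaultHarmonicForms_le_dolbeaultClosedForms_of_isManifold_holds`.

## Correction of `dolbeaultHarmonicForms_le_dolbeaultClosedForms` (provefact pass, 2026-08-15)

The `def … : Prop` sits in `section Hermitian` of `KaehlerHodge.lean` after
`variable [IsManifold 𝓘(ℂ, E) ω M] [IsManifold 𝓘(ℝ, E) ∞ M] (g) (o)`, but a `def` abstracts only
the section variables its body uses, and the body does not use the holomorphic atlas: `#check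
@dolbeaultHarmonicForms_le_dolbeaultClosedForms` binds `E`, `M`, their normed-space / charted-space
instances, `m`, `[FiniteDimensional ℂ E]`, `n`, `[Fact (finrank ℝ E = n)]`,
`[IsManifold 𝓘(ℝ, E) ∞ M]`, `g`, `o` — and **no `[IsManifold 𝓘(ℂ, E) ω M]`**. As elaborated it
therefore speaks about every compact real `C^∞` manifold charted on the complex vector space `E`,
the "complex structure" `J = i •` of `TangentSpace 𝓘(ℝ, E) x = E`, the types `(p,q)` and
`∂̄ = Σ (dα^{p,q})^{p,q+1}` being read in the frame of the preferred chart `chartAt x` of a merely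
smooth atlas, whereas Voisin's and Huybrechts' statement and proof are about complex manifolds
(Lemma 5.8 uses `d = ∂ + ∂̄` and the smoothness of `∂̄α`, i.e. the integrability supplied by the
holomorphic atlas). This is the defect documented, with counterexamples in that generality, for
the sibling facts of the same section: `isDolbeaultHarmonic_iff`
(`KaehlerHodgeDolbeaultHarmonicProofs.lean`: a `4`-torus with interleaved `i`- and `J`-holomorphic
affine charts carries a smooth `(1,1)`-form `α` with `Δ_∂̄ α = 0` — all second chart-wise
derivatives being junk zeros — and `∂̄α ≠ 0`; the same `α` lies in `ℋ^{1,1}` and not in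
`Z^{1,1}_{∂̄}`, so it refutes the present fact as elaborated too), `cl2Inner_dolbeaultBar_left`
(`KaehlerHodgeAdjointFact.lean`) and `finite_dolbeaultHarmonicForms`
(`KaehlerHodgeComplexAtlasFact.lean`). Following the provefact protocol (a mis-stated named fact is
corrected under a new name, never edited in place), this file proves the result under the intended
hypothesis (`…_of_inner_tangentJ`), gives the bridge to the `Prop` as declared at a complex manifold
(`…_of_isManifold_complex`), and vendors the corrected closed statement with the holomorphic atlas
as a binder *of the statement* (`…_of_isManifold`, the pattern of
`isDolbeaultHarmonic_iff_of_isManifold`) together with its discharge (`…_of_isManifold_holds`).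

## References

* C. Voisin, *Hodge Theory and Complex Algebraic Geometry I*, Cambridge Studies in Advanced
  Mathematics 76 (2002), §5.1.3 (Lemma 5.8), §5.1.4 (Lemma 5.12, Cor. 5.13, Def. 5.14),
  pp. 121–125.
* D. Huybrechts, *Complex Geometry. An Introduction*, Universitext (2005), §3.2, Lemma 3.2.3,
  Def. 3.2.4, Lemma 3.2.5, p. 126.
-/

noncomputable section

open scoped Manifold ContDiff Topology ComplexConjugate RealInnerProductSpace
open Bundle Module Set

namespace Literature.NumberTheory.Transcendental

open Literature.Geometry.Kaehler

variable {E : Type*} [NormedAddCommGroup E] [NormedSpace ℂ E]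
  {M : Type*} [TopologicalSpace M] [ChartedSpace E M] {k m : ℕ}
  [FiniteDimensional ℂ E] {n : ℕ} [Fact (finrank ℝ E = n)]
  [IsManifold 𝓘(ℂ, E) ω M] [IsManifold 𝓘(ℝ, E) ∞ M]

/-! ### `Ker Δ_∂̄ ⊆ Ker ∂̄` in every degree -/

section Harmonic

variable [RiemannianBundle (fun x : M ↦ TangentSpace 𝓘(ℝ, E) x)]
  [IsContinuousRiemannianBundle E (fun x : M ↦ TangentSpace 𝓘(ℝ, E) x)]
  [IsContMDiffRiemannianBundle 𝓘(ℝ, E) ∞ E (fun x : M ↦ TangentSpace 𝓘(ℝ, E) x)]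
  [CompactSpace M] [T2Space M]
  (o : (x : M) → Orientation ℝ (TangentSpace 𝓘(ℝ, E) x) (Fin n))

/-- **`Δ_∂̄`-harmonic functions are `∂̄`-closed** (compact complex manifold, `C^∞` Hermitian metric,
`vol_o` smooth): the degree-`0` patterns of `dolbeaultLaplacian`. For `0 + (m + 1) = n` the
Laplacian on functions is `Δ_∂̄ = ∂̄*∂̄`, and `0 = ⟪α, ∂̄*∂̄α⟫ = ⟪∂̄α, ∂̄α⟫` by the adjointness
`MForm.cl2Inner_dolbeaultBar_left_of_isHermitian` (Voisin (2002), Lemma 5.8; Huybrechts (2005),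
Lemma 3.2.3), whence `∂̄α = 0` (`eq_zero_of_cl2Inner_self_eq_zero`); for `0 + 0 = n` the manifold
is `0`-dimensional and `∂̄α` is a `1`-form, hence `0` (`cform_eq_zero_of_finrank_lt`). Voisin
(2002), Cor. 5.13 (`Ker Δ_∂̄ = Ker ∂̄ ∩ Ker ∂̄*`, degree `0`: `Ker Δ_∂̄ = Ker ∂̄`); Huybrechts (2005),
Lemma 3.2.5. [cite: Voisin2002, Cor. 5.13] -/
theorem dolbeaultBar_eq_zero_of_isDolbeaultHarmonic_zero
    (hJ : ∀ (x : M) (v w : TangentSpace 𝓘(ℝ, E) x), ⟪tangentJ E x v, tangentJ E x w⟫ = ⟪v, w⟫)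
    (ho : IsSmoothForm (riemannianVolumeForm o)) {p q : ℕ} (h : 0 + m = n)
    {α : MForm 𝓘(ℝ, E) M ℂ 0} (hα : IsDolbeaultHarmonic o p q h α) : dolbeaultBar α = 0 := by
  letI : MeasurableSpace E := borel E
  haveI : BorelSpace E := ⟨rfl⟩
  obtain ⟨hs, -, hΔ⟩ := hα
  rcases m with - | m'
  · exact cform_eq_zero_of_finrank_lt (n := n) (by omega) (dolbeaultBar α)
  · have h1 : (0 + 1) + m' = n := by omega
    have hΔ' : dolbeaultBarAdjoint o h1 (dolbeaultBar α) = 0 := hΔ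
    have hdbs : IsSmoothForm (dolbeaultBar α) := hs.dolbeaultBar
    -- `‖∂̄α‖² = ⟪α, ∂̄*∂̄α⟫ = ⟪α, 0⟫ = 0`
    have key := MForm.cl2Inner_dolbeaultBar_left_of_isHermitian o hJ ho h1 hs hdbs
    rw [hΔ', MForm.cl2Inner_zero_right] at key
    exact eq_zero_of_cl2Inner_self_eq_zero o ho h1 hdbs key

/-- **`∂̄`-harmonic forms are `∂̄`-closed, in every degree** (compact complex manifold, `C^∞` metric
Hermitian in the instance form `hJ : ⟪Jv, Jw⟫ = ⟪v, w⟫`, `vol_o` smooth): if `α` is smooth of type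
`(p,q)` with `Δ_∂̄ α = 0` (degrees `k + m = n`), then `∂̄α = 0`. In positive degree `k + 1` this is
the forward half of `isDolbeaultHarmonic_iff_of_inner_tangentJ` (Voisin (2002), Cor. 5.13;
Huybrechts (2005), Lemma 3.2.5: `0 = ⟪Δ_∂̄α, α⟫ = ‖∂̄*α‖² + ‖∂̄α‖²`); in degree `0` it is
`dolbeaultBar_eq_zero_of_isDolbeaultHarmonic_zero`. [cite: Voisin2002, Cor. 5.13] -/
theorem IsDolbeaultHarmonic.dolbeaultBar_eq_zero
    (hJ : ∀ (x : M) (v w : TangentSpace 𝓘(ℝ, E) x), ⟪tangentJ E x v, tangentJ E x w⟫ = ⟪v, w⟫)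
    (ho : IsSmoothForm (riemannianVolumeForm o)) {p q : ℕ} (h : k + m = n)
    {α : MForm 𝓘(ℝ, E) M ℂ k} (hα : IsDolbeaultHarmonic o p q h α) :
    Literature.NumberTheory.Transcendental.dolbeaultBar α = 0 := by
  rcases k with - | k'
  · exact dolbeaultBar_eq_zero_of_isDolbeaultHarmonic_zero o hJ ho h hα
  · exact ((isDolbeaultHarmonic_iff_of_inner_tangentJ o hJ ho h hα.1 hα.2.1).1 hα).1

/-- **`ℋ^{p,q} ≤ Z^{p,q}_{∂̄}` on a compact Hermitian manifold** (complex manifold, `C^∞` metric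
Hermitian in the instance form `hJ`, `vol_o` smooth): the span `dolbeaultHarmonicForms o p q h` of
the `∂̄`-harmonic `(p,q)`-forms lies in the span `dolbeaultClosedForms E M p q` of the `∂̄`-closed
smooth `(p,q)`-forms, since each generator is smooth, of type `(p,q)` and `∂̄`-closed
(`IsDolbeaultHarmonic.dolbeaultBar_eq_zero`, `mem_dolbeaultClosedForms`, `Submodule.span_le`).
Voisin (2002), §5.1.4, Cor. 5.13 with Def. 5.14 (`ℋ^{p,q} = Ker Δ_∂̄ ⊆ Ker ∂̄`); Huybrechts (2005),
Def. 3.2.4 and Lemma 3.2.5. The usable form of the named fact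
`dolbeaultHarmonicForms_le_dolbeaultClosedForms`. [cite: Voisin2002, Cor. 5.13] -/
theorem dolbeaultHarmonicForms_le_dolbeaultClosedForms_of_inner_tangentJ
    (hJ : ∀ (x : M) (v w : TangentSpace 𝓘(ℝ, E) x), ⟪tangentJ E x v, tangentJ E x w⟫ = ⟪v, w⟫)
    (ho : IsSmoothForm (riemannianVolumeForm o)) {p q : ℕ} (h : (p + q) + m = n) :
    dolbeaultHarmonicForms o p q h ≤ dolbeaultClosedForms E M p q :=
  Submodule.span_le.2 fun _ hα ↦
    mem_dolbeaultClosedForms hα.1 hα.2.1 (IsDolbeaultHarmonic.dolbeaultBar_eq_zero o hJ ho h hα)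

end Harmonic

/-! ### The named fact under a holomorphic atlas -/

section NamedFact

variable (g : ContMDiffRiemannianMetric 𝓘(ℝ, E) ∞ E (fun x : M ↦ TangentSpace 𝓘(ℝ, E) x))
  (o : (x : M) → Orientation ℝ (TangentSpace 𝓘(ℝ, E) x) (Fin n))

/-- **Bridge to the named fact as declared.** On a *complex* manifold (holomorphic atlas
`[IsManifold 𝓘(ℂ, E) ω M]`, the instance the `def` of `dolbeaultHarmonicForms_le_dolbeaultClosedForms`
does not bind), the named fact `dolbeaultHarmonicForms_le_dolbeaultClosedForms g o` of
`KaehlerHodge.lean` holds: its body quantifies `[CompactSpace M] [T2Space M]`, the Hermitian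
hypothesis `hg`, the bidegree and `ho` itself, and is then
`dolbeaultHarmonicForms_le_dolbeaultClosedForms_of_inner_tangentJ` for the instance
`⟨g.toRiemannianMetric⟩` (for which `hg` reads `⟪Jv, Jw⟫ = ⟪v, w⟫` and Mathlib's
`IsContMDiffRiemannianBundle` / `IsContinuousRiemannianBundle` hold). This feeds the hypothesis
`h₁ : ∀ {m}, dolbeaultHarmonicForms_le_dolbeaultClosedForms g o` of
`Literature/AlgebraicGeometry/Motives/HodgeDecompositionProofs.lean`. Voisin (2002), Cor. 5.13;
Huybrechts (2005), Lemma 3.2.5. [cite: Voisin2002, Cor. 5.13] -/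
theorem dolbeaultHarmonicForms_le_dolbeaultClosedForms_of_isManifold_complex :
    dolbeaultHarmonicForms_le_dolbeaultClosedForms (m := m) g o := by
  intro _ _ hg p q h ho
  letI : RiemannianBundle (fun x : M ↦ TangentSpace 𝓘(ℝ, E) x) := ⟨g.toRiemannianMetric⟩
  haveI : IsContMDiffRiemannianBundle 𝓘(ℝ, E) ∞ E (fun x : M ↦ TangentSpace 𝓘(ℝ, E) x) :=
    ⟨g.inner, g.contMDiff, fun _ _ _ ↦ rfl⟩
  haveI : IsContinuousRiemannianBundle E (fun x : M ↦ TangentSpace 𝓘(ℝ, E) x) :=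
    ⟨g.inner, g.contMDiff.continuous, fun _ _ _ ↦ rfl⟩
  exact dolbeaultHarmonicForms_le_dolbeaultClosedForms_of_inner_tangentJ o
    (fun x v w ↦ hg x v w) ho h

end NamedFact

/-! ### The corrected named fact -/

section CorrectedFact

/-- **`ℋ^{p,q} ≤ Z^{p,q}_{∂̄}` on a compact Hermitian manifold, as a closed named fact, correctly
stated.** On a compact complex manifold `M` (holomorphic atlas, modelled on the finite-dimensional
complex normed space `E`), Hausdorff, with a `C^∞` Riemannian metric `g` on the real tangent bundle
which is Hermitian (`g(Jv, Jw) = g(v, w)`) and an orientation family `o` with smooth volume form,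
the space `ℋ^{p,q} = dolbeaultHarmonicForms o p q h` of `∂̄`-harmonic `(p,q)`-forms
(`(p + q) + m = dim_ℝ M`) is contained in the space `Z^{p,q}_{∂̄} = dolbeaultClosedForms E M p q` of
`∂̄`-closed smooth `(p,q)`-forms: C. Voisin, *Hodge Theory and Complex Algebraic Geometry I* (2002),
§5.1.4, Cor. 5.13, p. 125 ("On a compact manifold, we have `Ker Δ_d = Ker d ∩ Ker d*` and the
analogous equalities for the three other Laplacians") with Def. 5.14, from Lemma 5.12 and Lemma 5.8
(§5.1.3); D. Huybrechts, *Complex Geometry* (2005), Def. 3.2.4, Lemma 3.2.5.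
**Correction** of the named fact
`Literature.NumberTheory.Transcendental.dolbeaultHarmonicForms_le_dolbeaultClosedForms` of
`KaehlerHodge.lean`: that `def … : Prop`, written in a section declaring
`variable [IsManifold 𝓘(ℂ, E) ω M]`, does not use — hence does not bind — the holomorphic-atlas
instance, so it speaks about every compact real `C^∞` manifold charted on `E`, with the types and
`∂̄` read through the complex structures induced pointwise by the arbitrary charts `chartAt x`; in
that generality it is false (the `4`-torus with interleaved `i`- and `J`-holomorphic affine charts
of the module docstring of `KaehlerHodgeDolbeaultHarmonicProofs.lean` carries a smooth `(1,1)`-form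
in `ℋ^{1,1}` with `∂̄α ≠ 0`). Here `[IsManifold 𝓘(ℂ, E) ω M]` is a binder *of the statement* (the
pattern of `isDolbeaultHarmonic_iff_of_isManifold`; the real `C^∞` structure it implies is kept as a
separate binder, as in `KaehlerHodge.lean`); it is discharged by
`dolbeaultHarmonicForms_le_dolbeaultClosedForms_of_isManifold_holds`, the usable form is
`dolbeaultHarmonicForms_le_dolbeaultClosedForms_of_inner_tangentJ`, and under the holomorphic-atlas
instance the fact as declared is `dolbeaultHarmonicForms_le_dolbeaultClosedForms_of_isManifold_complex`.
[cite: Voisin2002, Cor. 5.13] -/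
def dolbeaultHarmonicForms_le_dolbeaultClosedForms_of_isManifold : Prop :=
  ∀ {E : Type*} [NormedAddCommGroup E] [NormedSpace ℂ E] {M : Type*} [TopologicalSpace M]
    [ChartedSpace E M] {m : ℕ} [FiniteDimensional ℂ E] {n : ℕ} [Fact (finrank ℝ E = n)]
    [IsManifold 𝓘(ℂ, E) ω M] [IsManifold 𝓘(ℝ, E) ∞ M]
    (g : ContMDiffRiemannianMetric 𝓘(ℝ, E) ∞ E (fun x : M ↦ TangentSpace 𝓘(ℝ, E) x))
    (o : (x : M) → Orientation ℝ (TangentSpace 𝓘(ℝ, E) x) (Fin n)) [CompactSpace M] [T2Space M],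
    g.toRiemannianMetric.IsHermitian → ∀ {p q : ℕ} (h : (p + q) + m = n),
      letI : RiemannianBundle (fun x : M ↦ TangentSpace 𝓘(ℝ, E) x) := ⟨g.toRiemannianMetric⟩
      IsSmoothForm (riemannianVolumeForm o) →
        dolbeaultHarmonicForms o p q h ≤ dolbeaultClosedForms E M p q

/-- **Discharge** of `dolbeaultHarmonicForms_le_dolbeaultClosedForms_of_isManifold` (the corrected
form of the named fact `dolbeaultHarmonicForms_le_dolbeaultClosedForms`): immediate from
`dolbeaultHarmonicForms_le_dolbeaultClosedForms_of_isManifold_complex`. Voisin (2002), Cor. 5.13,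
p. 125; Huybrechts (2005), Lemma 3.2.5. [cite: Voisin2002, Cor. 5.13] -/
theorem dolbeaultHarmonicForms_le_dolbeaultClosedForms_of_isManifold_holds :
    dolbeaultHarmonicForms_le_dolbeaultClosedForms_of_isManifold := by
  intro E _ _ M _ _ m _ n _ _ _ g o _ _ hg p q h ho
  exact dolbeaultHarmonicForms_le_dolbeaultClosedForms_of_isManifold_complex g o hg h ho

end CorrectedFact

end Literature.NumberTheory.Transcendental
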